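import Literature.NumberTheory.LFunctions.Zhang2022.AppendixALemma83CaseOne
import Literature.NumberTheory.LFunctions.Zhang2022.RepairGapAppendixALocalFree
import HarnessLib

/-!
# Zhang (2022), rescue GAP/BED (D-0124 (3)(4)): Appendix A Case 1 — Z22:§A.u013 and (A.1) GUARD-FREE

Topic `Literature/NumberTheory/LFunctions/Zhang2022` (Landau–Siegel audit tree; verdict-neutral).
Y. Zhang, *Discrete mean estimates and the Landau–Siegel zero*, arXiv:2211.02515v1 (2022)
[Zhang2022LandauSiegel] — **an unrefereed manuscript under adjudication; nothing in this file asserts or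
denies its Theorems 1–2, and nothing here is a claim about Landau–Siegel zeros. The programme SEARCHES and
TYPES; no claim about Landau–Siegel zeros, Theorems 1–2 of arXiv:2211.02515 or a repaired Margin232 until a
kernel theorem says so.**

The typed campaign nodes of Case 1 (`(q,dh) = 1`) of the printed proof of Lemma 8.3 — `Typed.AppendixA1.StepA_u013`
(App. A p. 102, tex L5042: `Σ_r χ(q^r)ξ_j(q^r;d,h)/q^{rs} = (1−u)^{−2}(1/(1−vu) − 1) + O(α log q/q)`) and
the display **(A.1)** `EqA_1` (`𝔱_j(d,h,s;q) = 1 + O(α log q/q)`, tex L5008, via the deduction `DedA1`) —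
are typed under the standing guard `AssumptionA D χ →`, which their tree proofs (`Lemma83.stepA_u013_holds`,
`dedA1_holds`, `eqA_1_holds`, file `AppendixALemma83CaseOne`) never use. This file re-runs those proofs
VERBATIM with the guard binder deleted: `stepA_u013_free` (same `C = 2·10⁷`, same threshold) and
`eqA_1_free` = the body of `dedA1_holds` fed with `stepA_u013_free`, `stepA_u014_free`, `stepA_u015_free`
(file `RepairGapAppendixALocalFree`). Second input layer of the guard-free Lemma 8.3 (relative) chain
(rescue GAP row G-31; target: the Lemma 8.4 leaf at (A)-exponent 15 unconditional through
`Lemma84.lemma84Rel_pow15_of_lemma83Rel_pow15`). Theorems only; no definition, no named fact; nothing about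
(A) itself. Private series helpers copied unchanged from the tree file; the public per-`(D,q)` engines
(`stepA_u012_corrected`, `frame_X`, `frame_t`, `xiPowSum_eq`) are the tree's.

## References

* Y. Zhang, arXiv:2211.02515v1 (2022), Appendix A p. 102. [cite: Zhang2022LandauSiegel, App. A]
-/

noncomputable section

open Complex Real ComplexConjugate Finset

namespace Literature.NumberTheory.LFunctions.Zhang2022.Repair.Gap

open Literature.NumberTheory.LFunctions.Zhang2022
open Literature.NumberTheory.LFunctions.Zhang2022.Skeleton
open Literature.NumberTheory.LFunctions.Zhang2022.MeanSquareMajorant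
open Literature.NumberTheory.LFunctions.Zhang2022.Typed.AppendixA1
open Literature.NumberTheory.LFunctions.Zhang2022.Lemma83

/-! ## Private numeric helpers (copied from `AppendixALemma83CaseOne`) -/

/-- `(r+2)³ ≤ 64·(3/2)^r`. [folklore] -/
private theorem pow_three_le (r : ℕ) : ((r : ℝ) + 2) ^ 3 ≤ 64 * (3 / 2 : ℝ) ^ r := by
  have step : ∀ n : ℕ, 5 ≤ n → ((n : ℝ) + 2) ^ 3 ≤ 64 * (3 / 2 : ℝ) ^ n →
      (((n + 1 : ℕ) : ℝ) + 2) ^ 3 ≤ 64 * (3 / 2 : ℝ) ^ (n + 1) := by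
    intro n hn ih
    have hn' : (5 : ℝ) ≤ n := by exact_mod_cast hn
    have key : ((n : ℝ) + 1 + 2) ^ 3 ≤ (3 / 2) * ((n : ℝ) + 2) ^ 3 := by
      have h1 : ((n : ℝ) + 3) ≤ (8 / 7) * ((n : ℝ) + 2) := by linarith
      have h2 : 0 ≤ (n : ℝ) + 3 := by linarith
      calc ((n : ℝ) + 1 + 2) ^ 3 = ((n : ℝ) + 3) ^ 3 := by ring
        _ ≤ ((8 / 7) * ((n : ℝ) + 2)) ^ 3 := pow_le_pow_left₀ h2 h1 3
        _ = (8 / 7) ^ 3 * ((n : ℝ) + 2) ^ 3 := by ring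
        _ ≤ (3 / 2) * ((n : ℝ) + 2) ^ 3 := by
            apply mul_le_mul_of_nonneg_right (by norm_num) (by positivity)
    calc (((n + 1 : ℕ) : ℝ) + 2) ^ 3 = ((n : ℝ) + 1 + 2) ^ 3 := by push_cast; ring
      _ ≤ (3 / 2) * ((n : ℝ) + 2) ^ 3 := key
      _ ≤ (3 / 2) * (64 * (3 / 2 : ℝ) ^ n) := by gcongr
      _ = 64 * (3 / 2 : ℝ) ^ (n + 1) := by ring
  rcases Nat.lt_or_ge r 5 with hr | hr
  · interval_cases r <;> norm_num
  · induction r, hr using Nat.le_induction with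
    | base => norm_num
    | succ n hn ih => exact step n hn ih

/-- Outer sums: if `‖Z‖ ≤ 3/5` and `‖f(r)‖ ≤ E(r+2)³` then `Σ_r Z^{r+1}f(r)` converges absolutely
with norm `≤ 640E‖Z‖`. [folklore] -/
private theorem tsum_pow_succ_mul_cubic_bound {Z : ℂ} (hZ : ‖Z‖ ≤ 3 / 5) {f : ℕ → ℂ} {E : ℝ}
    (hE : 0 ≤ E) (hf : ∀ r : ℕ, ‖f r‖ ≤ E * ((r : ℝ) + 2) ^ 3) :
    Summable (fun r : ℕ => Z ^ (r + 1) * f r) ∧ ‖∑' r : ℕ, Z ^ (r + 1) * f r‖ ≤ 640 * E * ‖Z‖ := by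
  have hterm : ∀ r : ℕ, ‖Z ^ (r + 1) * f r‖ ≤ 64 * E * ‖Z‖ * (9 / 10 : ℝ) ^ r := fun r => by
    rw [norm_mul, norm_pow, pow_succ]
    have h1 : ‖Z‖ ^ r ≤ (3 / 5 : ℝ) ^ r := pow_le_pow_left₀ (norm_nonneg _) hZ r
    calc ‖Z‖ ^ r * ‖Z‖ * ‖f r‖ ≤ (3 / 5 : ℝ) ^ r * ‖Z‖ * (E * ((r : ℝ) + 2) ^ 3) := by
          gcongr; exact hf r
      _ ≤ (3 / 5 : ℝ) ^ r * ‖Z‖ * (E * (64 * (3 / 2 : ℝ) ^ r)) := by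
          gcongr; exact pow_three_le r
      _ = 64 * E * ‖Z‖ * ((3 / 5 : ℝ) ^ r * (3 / 2) ^ r) := by ring
      _ = 64 * E * ‖Z‖ * (9 / 10 : ℝ) ^ r := by rw [← mul_pow]; norm_num
  have hgeo : HasSum (fun r : ℕ => 64 * E * ‖Z‖ * (9 / 10 : ℝ) ^ r) (64 * E * ‖Z‖ * 10) := by
    have h := (hasSum_geometric_of_lt_one (by norm_num : (0 : ℝ) ≤ 9 / 10) (by norm_num)).mul_left
      (64 * E * ‖Z‖)
    have e : 64 * E * ‖Z‖ * (1 - 9 / 10 : ℝ)⁻¹ = 64 * E * ‖Z‖ * 10 := by norm_num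
    rwa [e] at h
  refine ⟨Summable.of_norm_bounded hgeo.summable hterm, ?_⟩
  calc ‖∑' r : ℕ, Z ^ (r + 1) * f r‖ ≤ 64 * E * ‖Z‖ * 10 := tsum_of_norm_bounded hgeo hterm
    _ = 640 * E * ‖Z‖ := by ring

/-- `Σ_{r≥0} Z^{r+1} = 1/(1−Z) − 1` for `‖Z‖ < 1`. [folklore] -/
private theorem hasSum_pow_succ' {Z : ℂ} (hZ : ‖Z‖ < 1) :
    HasSum (fun r : ℕ => Z ^ (r + 1)) (1 / (1 - Z) - 1) := by
  have h1 : 1 - Z ≠ 0 := sub_ne_zero.mpr (fun h => by rw [← h, norm_one] at hZ; exact lt_irrefl _ hZ)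
  have h := (hasSum_geometric_of_norm_lt_one hZ).mul_left Z
  simp only [← pow_succ'] at h
  have e : Z * (1 - Z)⁻¹ = 1 / (1 - Z) - 1 := by field_simp; ring
  rwa [e] at h

/-- `‖1/(1−a) − 1/(1−b)‖ ≤ (25/4)‖a − b‖` for `‖a‖, ‖b‖ ≤ 3/5`. [folklore] -/
private theorem norm_inv_sub_inv_le' {a b : ℂ} (ha : ‖a‖ ≤ 3 / 5) (hb : ‖b‖ ≤ 3 / 5) :
    ‖1 / (1 - a) - 1 / (1 - b)‖ ≤ 25 / 4 * ‖a - b‖ := by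
  have hna : 2 / 5 ≤ ‖1 - a‖ := by
    linarith [norm_le_norm_add_norm_sub' (1 : ℂ) a, norm_one (α := ℂ)]
  have hnb : 2 / 5 ≤ ‖1 - b‖ := by
    linarith [norm_le_norm_add_norm_sub' (1 : ℂ) b, norm_one (α := ℂ)]
  have ha0 : 1 - a ≠ 0 := fun h => by rw [h, norm_zero] at hna; linarith
  have hb0 : 1 - b ≠ 0 := fun h => by rw [h, norm_zero] at hnb; linarith
  have e : 1 / (1 - a) - 1 / (1 - b) = (a - b) / ((1 - a) * (1 - b)) := by field_simp; ring
  rw [e, norm_div, norm_mul]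
  rw [div_le_iff₀ (by positivity)]
  nlinarith [norm_nonneg (a - b), mul_le_mul hna hnb (by norm_num) (norm_nonneg _)]

/-! ## Z22:§A.u013 guard-free -/

/-- **Z22:§A.u013, GUARD-FREE** (App. A p. 102, tex L5042; twin of `Lemma83.stepA_u013_holds` with the unused
binder `AssumptionA D χ` deleted): for `(q,dh) = 1`, `|s − 1| < 5α`, `q < D`, `(q,D) = 1`:
`‖Σ_r χ(q^r)ξ_j(q^r;d,h)/q^{rs} − (1−u)^{−2}(1/(1−vu) − 1)‖ ≤ 2·10⁷·α log q/q` for all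
`D ≥ exp(10|c′|π + 400)` and every real primitive `χ` — no hypothesis on `L(1,χ)`.
[cite: Zhang2022LandauSiegel, App. A p. 102] -/
theorem stepA_u013_free (c' : ℝ) :
    ∃ C : ℝ, ForAllLarge fun D _ χ => ∀ j ∈ ({1, 2, 3} : Finset ℕ), ∀ d h : ℕ,
      1 ≤ d → 1 ≤ h → ((d * h : ℕ) : ℝ) < bigP D / bigT D ^ 2 → ∀ q : ℕ, q.Prime → ∀ s : ℂ,
        CondA9 D s q → Nat.Coprime q (d * h) →
          ‖xiPowSum c' χ j d h s q - 1 / (1 - uA q) ^ 2 * (1 / (1 - vA χ q * uA q) - 1)‖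
            ≤ C * (alpha D * Real.log q / q) := by
  refine ⟨20000000, ⌈Real.exp (10 * |c'| * π + 400)⌉₊,
    fun D _ χ hD _ _ j _ d h hd hh _ q hq s hcond hqdh => ?_⟩
  have hD' : Real.exp (10 * |c'| * π + 400) ≤ D := le_trans (Nat.le_ceil _) (by exact_mod_cast hD)
  obtain ⟨hℓ3, hα, hB, hαℓ⟩ := largeD_bounds c' hD'
  obtain ⟨hs, hqD, hcop⟩ := hcond
  obtain ⟨hXu, hXn, hun, hqinv, hlogq, hlogq0⟩ := frame_X c' hD' hq hqD hs
  set B : ℝ := |b1 c' D| + |b2 c' D| + |b3 c' D| with hBdef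
  set v : ℂ := χ (q : ZMod D) with hv
  set X : ℂ := (q : ℂ) ^ (-s) with hX
  set u : ℂ := ((q : ℂ))⁻¹ with hu
  have hB0 : 0 ≤ B := by positivity
  have hvn : ‖v‖ ≤ 1 := χ.norm_le_one _
  have hvX : ‖v * X‖ ≤ 3 / 5 := by
    rw [norm_mul]; nlinarith [norm_nonneg v, norm_nonneg X]
  have hvu : ‖v * u‖ ≤ 3 / 5 := by
    rw [norm_mul]; nlinarith [norm_nonneg v, norm_nonneg u]
  have hvXu : ‖v * X - v * u‖ ≤ 10 * alpha D * Real.log q * (q : ℝ)⁻¹ := by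
    rw [← mul_sub, norm_mul]; nlinarith [norm_nonneg v, norm_nonneg (X - u)]
  have hvX2 : ‖v * X‖ ≤ 2 * (q : ℝ)⁻¹ := by
    have h1 : ‖X‖ ≤ ‖X - u‖ + ‖u‖ := by
      have := norm_add_le (X - u) u; rwa [sub_add_cancel] at this
    have h2 : ‖u‖ = (q : ℝ)⁻¹ := by rw [hu, norm_inv, Complex.norm_natCast]
    have h3 : 10 * alpha D * Real.log q * (q : ℝ)⁻¹ ≤ (q : ℝ)⁻¹ := by
      have : 10 * alpha D * Real.log q ≤ 10 * (alpha D * ell D) := by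
        calc _ ≤ 10 * alpha D * ell D := by gcongr
          _ = _ := by ring
      have hq0' : (0 : ℝ) ≤ (q : ℝ)⁻¹ := by positivity
      nlinarith
    calc ‖v * X‖ ≤ ‖X‖ := by rw [norm_mul]; nlinarith [norm_nonneg v, norm_nonneg X]
      _ ≤ 2 * (q : ℝ)⁻¹ := by linarith
  have hu1 : 1 - u ≠ 0 := by
    intro h0
    have : ‖(1 : ℂ)‖ ≤ 1 / 2 := by rw [show (1 : ℂ) = u by linear_combination h0]; exact hun
    rw [norm_one] at this; linarith
  set m : ℂ := 1 / (1 - u) ^ 2 with hm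
  have hmn : ‖m‖ ≤ 4 := by
    have hden : 1 / 2 ≤ ‖1 - u‖ := by
      linarith [norm_le_norm_add_norm_sub' (1 : ℂ) u, norm_one (α := ℂ)]
    rw [hm, norm_div, norm_one, norm_pow, div_le_iff₀ (by positivity)]
    nlinarith [pow_le_pow_left₀ (by norm_num : (0:ℝ) ≤ 1 / 2) hden 2]
  -- coefficients within `2052·B log q·(r+2)³` of `m`
  have hE : ∀ r : ℕ, ‖xiA c' D j (q ^ (r + 1)) d h - m‖ ≤ (2052 * (B * Real.log q)) * ((r : ℝ) + 2) ^ 3 :=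
    fun r => by
      have h := stepA_u012_corrected c' D j d h hq hd hh hqD hcop hqdh (n := r + 1) (by omega)
      calc _ ≤ 2052 * (B * Real.log q) * (((r + 1 : ℕ) : ℝ) + 1) ^ 3 := h
        _ = (2052 * (B * Real.log q)) * ((r : ℝ) + 2) ^ 3 := by push_cast; ring
  have hsplit : ∀ r : ℕ, (v * X) ^ (r + 1) * xiA c' D j (q ^ (r + 1)) d h =
      m * (v * X) ^ (r + 1) + (v * X) ^ (r + 1) * (xiA c' D j (q ^ (r + 1)) d h - m) := fun r => by
    ring
  obtain ⟨hsumR, hR⟩ := tsum_pow_succ_mul_cubic_bound hvX (by positivity) hE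
  have hlt : ‖v * X‖ < 1 := lt_of_le_of_lt hvX (by norm_num)
  have hmain := (hasSum_pow_succ' hlt).mul_left m
  rw [xiPowSum_eq c' χ j d h s hq.pos]
  have htot : ∑' r : ℕ, (v * X) ^ (r + 1) * xiA c' D j (q ^ (r + 1)) d h =
      m * (1 / (1 - v * X) - 1) +
        ∑' r : ℕ, (v * X) ^ (r + 1) * (xiA c' D j (q ^ (r + 1)) d h - m) := by
    rw [tsum_congr hsplit, hmain.summable.tsum_add hsumR, hmain.tsum_eq]
  rw [htot]
  have huA : uA q = u := rfl
  have hvA : vA χ q = v := rfl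
  rw [huA, hvA]
  have e : m * (1 / (1 - v * X) - 1) +
      (∑' r : ℕ, (v * X) ^ (r + 1) * (xiA c' D j (q ^ (r + 1)) d h - m)) -
      1 / (1 - u) ^ 2 * (1 / (1 - v * u) - 1) =
      m * (1 / (1 - v * X) - 1 / (1 - v * u)) +
        ∑' r : ℕ, (v * X) ^ (r + 1) * (xiA c' D j (q ^ (r + 1)) d h - m) := by
    rw [hm]; ring
  rw [e]
  calc _ ≤ ‖m * (1 / (1 - v * X) - 1 / (1 - v * u))‖ +
        ‖∑' r : ℕ, (v * X) ^ (r + 1) * (xiA c' D j (q ^ (r + 1)) d h - m)‖ := norm_add_le _ _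
    _ ≤ 4 * (25 / 4 * ‖v * X - v * u‖) + 640 * (2052 * (B * Real.log q)) * ‖v * X‖ := by
        rw [norm_mul]
        exact add_le_add (mul_le_mul hmn (norm_inv_sub_inv_le' hvX hvu) (norm_nonneg _) (by norm_num)) hR
    _ ≤ 4 * (25 / 4 * (10 * alpha D * Real.log q * (q : ℝ)⁻¹)) +
          640 * (2052 * ((7 * alpha D) * Real.log q)) * (2 * (q : ℝ)⁻¹) := by
        gcongr
    _ = 18385920 * (alpha D * Real.log q / q) + 250 * (alpha D * Real.log q / q) := by ring
    _ ≤ 20000000 * (alpha D * Real.log q / q) := by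
        have : 0 ≤ alpha D * Real.log q / q := by positivity
        nlinarith


/-! ## (A.1) guard-free -/

/-- **(A.1), GUARD-FREE** (Z22:(A.1), App. A p. 101, tex L5008; the body of `Lemma83.dedA1_holds` — "This together
with [u014] and [u015] yields (A.1)" — run on the guard-free inputs `stepA_u013_free`, `stepA_u014_free`,
`stepA_u015_free`, the unused binder `AssumptionA D χ` deleted): for `(q,dh) = 1`, `|s − 1| < 5α`, `q < D`,
`(q,D) = 1`: `‖𝔱_j(d,h,s;q) − 1‖ ≤ C·α log q/q`, all large `D`, every real primitive `χ` — no hypothesis on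
`L(1,χ)`. Same constant as `eqA_1_holds`. [cite: Zhang2022LandauSiegel, App. A (A.1) p. 101] -/
theorem eqA_1_free (c' : ℝ) :
    ∃ C : ℝ, ForAllLarge fun D _ χ => ∀ j ∈ ({1, 2, 3} : Finset ℕ), ∀ d h : ℕ,
      1 ≤ d → 1 ≤ h → ((d * h : ℕ) : ℝ) < bigP D / bigT D ^ 2 → ∀ q : ℕ, q.Prime → ∀ s : ℂ,
        CondA9 D s q → Nat.Coprime q (d * h) →
          ‖frakt c' χ j d h s q - 1‖ ≤ C * (alpha D * Real.log q / q) := by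
  obtain ⟨C₁, D₁, h₁⟩ := stepA_u013_free c'
  obtain ⟨C₂, D₂, h₂⟩ := stepA_u014_free c'
  obtain ⟨C₃, D₃, h₃⟩ := stepA_u015_free c'
  refine ⟨|C₃| * (1 + (9 / 4 + |C₂|) * (4 + |C₁|)) + 3 / 2 * (|C₂| * (4 + |C₁|) + 9 / 4 * |C₁|),
    max (max (max D₁ D₂) D₃) ⌈Real.exp (10 * |c'| * π + 400)⌉₊,
    fun D _ χ hD hquad hprim j hj d h hd hh hdh q hq s hcond hqdh => ?_⟩
  have hD1 : D₁ ≤ D :=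
    le_trans (le_trans (le_trans (le_max_left _ _) (le_max_left _ _)) (le_max_left _ _)) hD
  have hD2 : D₂ ≤ D :=
    le_trans (le_trans (le_trans (le_max_right _ _) (le_max_left _ _)) (le_max_left _ _)) hD
  have hD3 : D₃ ≤ D := le_trans (le_trans (le_max_right _ _) (le_max_left _ _)) hD
  have hD' : Real.exp (10 * |c'| * π + 400) ≤ D :=
    le_trans (Nat.le_ceil _) (by exact_mod_cast le_trans (le_max_right _ _) hD)
  have e13 := h₁ D χ hD1 hquad hprim j hj d h hd hh hdh q hq s hcond hqdh
  have e14 := h₂ D χ hD2 hquad hprim j hj d h hd hh hdh q hq hcond.2.1 hcond.2.2 hqdh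
  have e15 := h₃ D χ hD3 hquad hprim j hj q hq s hcond
  obtain ⟨ht0, ht1, hun⟩ := frame_t c' hD' hq hcond.2.1
  set t : ℝ := alpha D * Real.log q / q with htdef
  set v : ℂ := vA χ q with hv
  set u : ℂ := uA q with hu
  have hvn : ‖v‖ ≤ 1 := χ.norm_le_one _
  have hun' : ‖u‖ ≤ 1 / 2 := hun
  have hvu : ‖v * u‖ ≤ 1 / 2 := by rw [norm_mul]; nlinarith [norm_nonneg v, norm_nonneg u]
  have hden : 1 / 2 ≤ ‖1 - v * u‖ := by
    linarith [norm_le_norm_add_norm_sub' (1 : ℂ) (v * u), norm_one (α := ℂ)]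
  have hden0 : 1 - v * u ≠ 0 := fun h0 => by rw [h0, norm_zero] at hden; linarith
  have hdenu : 1 / 2 ≤ ‖1 - u‖ := by
    linarith [norm_le_norm_add_norm_sub' (1 : ℂ) u, norm_one (α := ℂ)]
  have hdenu0 : 1 - u ≠ 0 := fun h0 => by rw [h0, norm_zero] at hdenu; linarith
  set P : ℂ := 1 - v * u with hP
  set L : ℂ := (1 - u) ^ 2 with hL
  set M : ℂ := 1 / (1 - u) ^ 2 * (1 / (1 - v * u) - 1) with hM
  have hPn : ‖P‖ ≤ 3 / 2 := by
    calc ‖P‖ ≤ ‖(1 : ℂ)‖ + ‖v * u‖ := norm_sub_le _ _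
      _ ≤ 3 / 2 := by rw [norm_one]; linarith
  have hLn : ‖L‖ ≤ 9 / 4 := by
    have : ‖1 - u‖ ≤ 3 / 2 := by
      calc ‖1 - u‖ ≤ ‖(1 : ℂ)‖ + ‖u‖ := norm_sub_le _ _
        _ ≤ 3 / 2 := by rw [norm_one]; linarith
    rw [hL, norm_pow]; nlinarith [norm_nonneg (1 - u)]
  have hMn : ‖M‖ ≤ 4 := by
    have h1 : ‖1 / (1 - u) ^ 2‖ ≤ 4 := by
      rw [norm_div, norm_one, norm_pow, div_le_iff₀ (by positivity)]
      nlinarith [pow_le_pow_left₀ (by norm_num : (0:ℝ) ≤ 1 / 2) hdenu 2]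
    have h2 : ‖1 / (1 - v * u) - 1‖ ≤ 1 := by
      have hne : (1 : ℂ) - v * u ≠ 0 := by rw [← hP]; exact hden0
      have e : 1 / (1 - v * u) - 1 = v * u / (1 - v * u) := by field_simp; ring
      rw [e, norm_div, div_le_iff₀ (by positivity)]
      linarith
    rw [hM, norm_mul]; nlinarith [norm_nonneg (1 / (1 - u) ^ 2), norm_nonneg (1 / (1 - v * u) - 1)]
  have hPLM : P * (1 + L * M) = 1 := by
    have h1 : (1 : ℂ) - v * u ≠ 0 := by rw [← hP]; exact hden0
    rw [hP, hL, hM]; field_simp; ring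
  -- the three estimates with absolute constants
  have e13' : ‖xiPowSum c' χ j d h s q - M‖ ≤ |C₁| * t :=
    le_trans e13 (by rw [htdef]; exact mul_le_mul_of_nonneg_right (le_abs_self _) ht0)
  have e14' : ‖lamTilde c' D q (d * h) (1 - betaJ c' D j) - L‖ ≤ |C₂| * t :=
    le_trans e14 (by rw [htdef]; exact mul_le_mul_of_nonneg_right (le_abs_self _) ht0)
  have e15' : ‖pref c' χ j s q - P‖ ≤ |C₃| * t :=
    le_trans e15 (by rw [htdef]; exact mul_le_mul_of_nonneg_right (le_abs_self _) ht0)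
  have hXi : ‖xiPowSum c' χ j d h s q‖ ≤ 4 + |C₁| := by
    have e : xiPowSum c' χ j d h s q = (xiPowSum c' χ j d h s q - M) + M := by ring
    rw [e]
    calc _ ≤ ‖xiPowSum c' χ j d h s q - M‖ + ‖M‖ := norm_add_le _ _
      _ ≤ |C₁| * t + 4 := add_le_add e13' hMn
      _ ≤ 4 + |C₁| := by nlinarith [abs_nonneg C₁]
  have hLam : ‖lamTilde c' D q (d * h) (1 - betaJ c' D j)‖ ≤ 9 / 4 + |C₂| := by
    have e : lamTilde c' D q (d * h) (1 - betaJ c' D j) =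
        (lamTilde c' D q (d * h) (1 - betaJ c' D j) - L) + L := by ring
    rw [e]
    calc _ ≤ ‖lamTilde c' D q (d * h) (1 - betaJ c' D j) - L‖ + ‖L‖ := norm_add_le _ _
      _ ≤ |C₂| * t + 9 / 4 := add_le_add e14' hLn
      _ ≤ 9 / 4 + |C₂| := by nlinarith [abs_nonneg C₂]
  have hS : ‖1 + lamTilde c' D q (d * h) (1 - betaJ c' D j) * xiPowSum c' χ j d h s q‖ ≤
      1 + (9 / 4 + |C₂|) * (4 + |C₁|) := by
    calc _ ≤ ‖(1 : ℂ)‖ + ‖lamTilde c' D q (d * h) (1 - betaJ c' D j) * xiPowSum c' χ j d h s q‖ :=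
          norm_add_le _ _
      _ ≤ 1 + (9 / 4 + |C₂|) * (4 + |C₁|) := by
          rw [norm_one, norm_mul]
          exact add_le_add le_rfl (mul_le_mul hLam hXi (norm_nonneg _) (by positivity))
  -- assemble
  unfold frakt
  set Lt := lamTilde c' D q (d * h) (1 - betaJ c' D j) with hLt
  set Xs := xiPowSum c' χ j d h s q with hXs
  have e : pref c' χ j s q * (1 + Lt * Xs) - 1 =
      (pref c' χ j s q - P) * (1 + Lt * Xs) + P * ((Lt - L) * Xs + L * (Xs - M)) := by
    linear_combination hPLM
  rw [e]
  calc _ ≤ ‖(pref c' χ j s q - P) * (1 + Lt * Xs)‖ + ‖P * ((Lt - L) * Xs + L * (Xs - M))‖ :=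
        norm_add_le _ _
    _ ≤ |C₃| * t * (1 + (9 / 4 + |C₂|) * (4 + |C₁|)) +
          3 / 2 * (|C₂| * t * (4 + |C₁|) + 9 / 4 * (|C₁| * t)) := by
        rw [norm_mul, norm_mul]
        refine add_le_add (mul_le_mul e15' hS (norm_nonneg _) (by positivity))
          (mul_le_mul hPn ?_ (norm_nonneg _) (by norm_num))
        calc ‖(Lt - L) * Xs + L * (Xs - M)‖ ≤ ‖(Lt - L) * Xs‖ + ‖L * (Xs - M)‖ := norm_add_le _ _
          _ ≤ |C₂| * t * (4 + |C₁|) + 9 / 4 * (|C₁| * t) := by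
              rw [norm_mul, norm_mul]
              exact add_le_add (mul_le_mul e14' hXi (norm_nonneg _) (by positivity))
                (mul_le_mul hLn e13' (norm_nonneg _) (by norm_num))
    _ = (|C₃| * (1 + (9 / 4 + |C₂|) * (4 + |C₁|)) + 3 / 2 * (|C₂| * (4 + |C₁|) + 9 / 4 * |C₁|)) *
          (alpha D * Real.log q / q) := by rw [htdef]; ring

end Literature.NumberTheory.LFunctions.Zhang2022.Repair.Gap

end
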